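import Mathlib.Analysis.SpecialFunctions.Trigonometric.Bounds
import Mathlib.Algebra.BigOperators.Intervals
import Mathlib.Algebra.BigOperators.Field
import Mathlib.Algebra.Order.BigOperators.Group.Finset

/-!
# The polygon Fermi level is optimal, II: the midpoint rule for `csc²` and the `+1 conditions`
# (T-M1D.48 Theorem B, Steps 3–4)

HONEST FRAMING: first certified bounds; not a superconductivity verdict; every number certified
or labelled float.  (Venture `CertifiedManyBodySolver`, programme `hubbard-alg`, team M1 seat 4
— the doped-point STRUCTURE seat; design note `structure/design/BLINDNESS-SANDWICH.md` §3,
entry T-M1D.48 "THEOREM B (the polygon Fermi level is optimal at every closed shell)", Steps 3,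
3′ and 4; part I is `CosecantSquareSums.lean` (Step 2: the sums (S1) `Σ_{j<n} csc²((2j+1)π/(2n))
= n²`, (S2) `Σ_{j=1}^{n−1} csc²(jπ/n) = (n²−1)/3`, the Dirichlet sums and the cap splittings);
this part does not import part I — the non-cap sums `S_out`, `S_out′` appear here as they are.)

Setting (T-M1D.48): ring of `n` sites, closed shell `ν = m/n`, `θ_F = mπ/n`; the `+1 condition`
of T-M1D.47 for the Hermite interpolant `T` of the hinge at the polygon Fermi level is
`T(0) > h(0) = 1 − cos θ_F` for `m = 2p` even and `T″(0) > h″(0) = −1` for `m = 2p+1` odd.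
With the Step-1 kernel values (on paper, NOT formalised here) these read
`n² T(0) = (1 − cos θ_F)(n² − S_out) + 2 sin θ_F / sin(π/n)`,
`S_out = Σ_{j=p}^{n−1−p} csc²((2j+1)π/(2n))`, and
`T″(0) = −½(1 − cos θ_F) S_out′ + sin θ_F / sin(π/n) − 1`, `S_out′ = Σ_{i=p+1}^{n−p−1} csc²(iπ/n)`,
so both conditions reduce (Step 3/3′) to the strict inequalities
`(★)  S_out  < 2cot(pπ/n)/sin(π/n)`  and  `(★′) S_out′ < 2cot((2p+1)π/(2n))/sin(π/n)`.

This file proves, for symbolic `n, p`: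
* `midpoint_cell_lt` (Step 4, one cell): for `0 < d < y`, `y + d < π`,
  `2d/sin² y < cot(y − d) − cot(y + d)` `(= ∫_{y−d}^{y+d} csc²)` — the midpoint rule strictly
  UNDER-estimates `csc²` on every cell; division-free core `d cos d < sin d` (Mathlib `Real.lt_tan`);
* `nonCap_sum_lt_even` **(★)** (`1 ≤ p`, `2p+1 ≤ n`) and `nonCap_sum_lt_odd` **(★′)** (`2p+2 ≤ n`):
  the non-cap half-angles are the midpoints of cells of width `π/n` tiling `[pπ/n, π − pπ/n]`,
  resp. `[(2p+1)π/(2n), π − (2p+1)π/(2n)]`; summing the cells telescopes the cotangents to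
  `(π/n)·S < 2cot(·)`, and `sin(π/n) ≤ π/n` (`Real.sin_le`) gives the stated form (the design
  note's intermediate `(2n/π)cot` bound is the `hA` step of the proofs);
* `plus_one_condition_even`, `plus_one_condition_odd`: the two displayed `+1 conditions` as scalar
  inequalities, i.e. `(★)`/`(★′)` multiplied back by `1 − cos θ_F = 2sin²(θ_F/2) > 0`
  (resp. `½(1 − cos θ_F)`), using `sin θ_F = 2 sin(θ_F/2) cos(θ_F/2)`.
Together with Steps 0–1 on paper these give Theorem B for every `n ≥ 4`, `2 ≤ m ≤ n − 2`
(even `m = 2p`: `1 ≤ p`, `2p+1 ≤ n`; odd `m = 2p+1`: `2p+2 ≤ n`).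

Float cross-check (labelled float, not part of the certificate): (★), (★′) and the cell
inequality were checked numerically for all admissible `(n, p)` with `n ≤ 120` before
formalisation (seat folder `py/sanity.py`; smallest slack of (★) ≈ 5.8e-5 in the normalisation
`(2n/π)cot − S`, near `n ≈ 119`).
-/

namespace Summit.Ventures.CertifiedManyBodySolver.Conjectures.CosecantMidpointCells

open Finset
open scoped Real

/-! ## §1 Midpoint cells for `csc²` (Step 4, one cell) -/

/-- **Midpoint cell inequality for `csc²`.** For `0 < d < y` with `y + d < π`:
`2d / sin² y < cot(y − d) − cot(y + d)` (`= ∫_{y−d}^{y+d} csc²`): on every cell the midpoint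
rule strictly UNDER-estimates the integral of `csc²`.  Division-free core: `d·cos d < sin d`. -/
theorem midpoint_cell_lt (d y : ℝ) (hd : 0 < d) (hdy : d < y) (hyd : y + d < π) :
    2 * d / Real.sin y ^ 2
      < Real.cos (y - d) / Real.sin (y - d) - Real.cos (y + d) / Real.sin (y + d) := by
  have hd2 : d < π / 2 := by linarith
  have hsd : 0 < Real.sin d := Real.sin_pos_of_pos_of_lt_pi hd (by linarith)
  have hcd : 0 < Real.cos d := Real.cos_pos_of_mem_Ioo ⟨by linarith, hd2⟩
  have hsy : 0 < Real.sin y := Real.sin_pos_of_pos_of_lt_pi (by linarith) (by linarith)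
  have hs1 : 0 < Real.sin (y - d) := Real.sin_pos_of_pos_of_lt_pi (by linarith) (by linarith)
  have hs2 : 0 < Real.sin (y + d) := Real.sin_pos_of_pos_of_lt_pi (by linarith) hyd
  have hPd := Real.sin_sq_add_cos_sq d
  have hPy := Real.sin_sq_add_cos_sq y
  -- `d cos d < sin d` (i.e. `d < tan d`)
  have htan : d * Real.cos d < Real.sin d := by
    have h := Real.lt_tan hd hd2
    rw [Real.tan_eq_sin_div_cos, lt_div_iff₀ hcd] at h
    exact h
  -- the key scalar inequality `2d·(sin² y − sin² d) < 2 sin d cos d · sin² y`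
  have key : 2 * d * (Real.sin y ^ 2 - Real.sin d ^ 2)
      < 2 * Real.sin d * Real.cos d * Real.sin y ^ 2 := by
    have e1 : 2 * d * Real.cos d ^ 2 < 2 * Real.sin d * Real.cos d := by
      have := mul_lt_mul_of_pos_right htan hcd
      linarith
    have e2 : Real.sin d * Real.cos d ≤ d :=
      (mul_le_of_le_one_right hsd.le (Real.cos_le_one d)).trans (Real.sin_le hd.le)
    have e3 : Real.sin y ^ 2 * (2 * d - 2 * Real.sin d * Real.cos d)
        ≤ 2 * d - 2 * Real.sin d * Real.cos d :=
      mul_le_of_le_one_left (by linarith) (Real.sin_sq_le_one y)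
    have hd' : 2 * d = 2 * d * (Real.sin d ^ 2 + Real.cos d ^ 2) := by rw [hPd]; ring
    have e4 : 2 * d - 2 * Real.sin d * Real.cos d < 2 * d * Real.sin d ^ 2 := by
      linarith [e1, hd']
    linarith [e3, e4]
  have hprod : Real.sin (y - d) * Real.sin (y + d) = Real.sin y ^ 2 - Real.sin d ^ 2 := by
    rw [Real.sin_sub, Real.sin_add]
    linear_combination (Real.sin y ^ 2) * hPd - (Real.sin d ^ 2) * hPy
  have hnum : Real.cos (y - d) * Real.sin (y + d) - Real.sin (y - d) * Real.cos (y + d)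
      = 2 * Real.sin d * Real.cos d := by
    rw [Real.cos_sub, Real.sin_add, Real.sin_sub, Real.cos_add]
    linear_combination (2 * Real.sin d * Real.cos d) * hPy
  rw [div_sub_div _ _ hs1.ne' hs2.ne', hnum, hprod]
  have hpos : 0 < Real.sin y ^ 2 - Real.sin d ^ 2 := by rw [← hprod]; exact mul_pos hs1 hs2
  rw [div_lt_div_iff₀ (pow_pos hsy 2) hpos]
  exact key

/-! ## §2 The reduced `+1 conditions` `(★)` and `(★′)` (Step 4 summed) -/

/-- **(★)** (shell `m = 2p` even, `1 ≤ p`, `2p + 1 ≤ n`): the `n − 2p` NON-cap half-angles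
`(2j+1)π/(2n)`, `p ≤ j ≤ n−1−p`, are the midpoints of the cells `[jπ/n, (j+1)π/n]` tiling
`[pπ/n, π − pπ/n]`, so `Σ_{j=p}^{n−1−p} csc²((2j+1)π/(2n)) < (2n/π)·cot(pπ/n) ≤ 2cot(pπ/n)/sin(π/n)`. -/
theorem nonCap_sum_lt_even (n p : ℕ) (hp : 1 ≤ p) (hpn : 2 * p + 1 ≤ n) :
    ∑ j ∈ Ico p (n - p), 1 / Real.sin ((2 * j + 1) * π / (2 * n)) ^ 2
      < 2 * (Real.cos (p * π / n) / Real.sin (p * π / n)) / Real.sin (π / n) := by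
  have hn : 0 < n := by omega
  have hnR : (0 : ℝ) < n := by exact_mod_cast hn
  have hnR0 : (n : ℝ) ≠ 0 := hnR.ne'
  have hpR : (1 : ℝ) ≤ p := by exact_mod_cast hp
  have hpnR : 2 * (p : ℝ) + 1 ≤ n := by exact_mod_cast hpn
  -- telescoping over `Ico`
  have tel : ∀ (g : ℕ → ℝ) (a b : ℕ), a ≤ b →
      ∑ j ∈ Ico a b, (g j - g (j + 1)) = g a - g b := by
    intro g a b hab
    induction b, hab using Nat.le_induction with
    | base => simp
    | succ b hab ih => rw [Finset.sum_Ico_succ_top hab, ih]; ring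
  set g : ℕ → ℝ := fun i => Real.cos (i * π / n) / Real.sin (i * π / n) with hg
  -- (i) each midpoint cell
  have hcell : ∀ j ∈ Ico p (n - p),
      2 * (π / (2 * n)) / Real.sin ((2 * j + 1) * π / (2 * n)) ^ 2 < g j - g (j + 1) := by
    intro j hj
    rw [mem_Ico] at hj
    have hj1 : (1 : ℝ) ≤ j := by exact_mod_cast (le_trans hp hj.1)
    have hj2 : (j : ℝ) + 2 ≤ n := by exact_mod_cast (by omega : j + 2 ≤ n)
    have hlt1 : π / (2 * n) < (2 * j + 1) * π / (2 * n) := by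
      apply div_lt_div_of_pos_right _ (by positivity)
      nlinarith [Real.pi_pos]
    have hlt2 : (2 * j + 1) * π / (2 * n) + π / (2 * n) < π := by
      rw [← add_div, div_lt_iff₀ (by positivity)]
      nlinarith [Real.pi_pos]
    have h := midpoint_cell_lt (π / (2 * n)) ((2 * j + 1) * π / (2 * n)) (by positivity) hlt1 hlt2
    have ey1 : (2 * (j : ℝ) + 1) * π / (2 * n) - π / (2 * n) = (j : ℝ) * π / n := by
      field_simp; ring
    have ey2 : (2 * (j : ℝ) + 1) * π / (2 * n) + π / (2 * n) = ((j + 1 : ℕ) : ℝ) * π / n := by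
      push_cast; field_simp; ring
    rw [ey1, ey2] at h
    exact h
  -- (ii) sum the cells: `(π/n)·S < 2·cot(pπ/n)`
  have hne : (Ico p (n - p)).Nonempty := by rw [Finset.nonempty_Ico]; omega
  have hA : π / n * ∑ j ∈ Ico p (n - p), 1 / Real.sin ((2 * j + 1) * π / (2 * n)) ^ 2
      < 2 * (Real.cos (p * π / n) / Real.sin (p * π / n)) := by
    have hlt := Finset.sum_lt_sum_of_nonempty hne hcell
    have eL : ∑ j ∈ Ico p (n - p), 2 * (π / (2 * n)) / Real.sin ((2 * j + 1) * π / (2 * n)) ^ 2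
        = π / n * ∑ j ∈ Ico p (n - p), 1 / Real.sin ((2 * j + 1) * π / (2 * n)) ^ 2 := by
      rw [Finset.mul_sum]
      refine sum_congr rfl fun j _ => ?_
      ring
    have eR : ∑ j ∈ Ico p (n - p), (g j - g (j + 1))
        = 2 * (Real.cos (p * π / n) / Real.sin (p * π / n)) := by
      rw [tel g p (n - p) (by omega)]
      have ec : (((n - p : ℕ)) : ℝ) * π / n = π - p * π / n := by
        rw [Nat.cast_sub (by omega)]; field_simp
      simp only [hg]
      rw [ec, Real.cos_pi_sub, Real.sin_pi_sub]
      ring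
    rw [eL, eR] at hlt
    exact hlt
  -- (iii) divide by `π/n` and use `sin(π/n) ≤ π/n`
  have hπn : 0 < π / n := by positivity
  have hsinpos : 0 < Real.sin (π / n) := by
    apply Real.sin_pos_of_pos_of_lt_pi hπn
    rw [div_lt_iff₀ hnR]
    nlinarith [Real.pi_pos]
  have hsinle : Real.sin (π / n) ≤ π / n := Real.sin_le hπn.le
  have hS0 : 0 ≤ ∑ j ∈ Ico p (n - p), 1 / Real.sin ((2 * j + 1) * π / (2 * n)) ^ 2 :=
    Finset.sum_nonneg fun j _ => by positivity
  rw [lt_div_iff₀ hsinpos]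
  calc (∑ j ∈ Ico p (n - p), 1 / Real.sin ((2 * j + 1) * π / (2 * n)) ^ 2) * Real.sin (π / n)
      ≤ (∑ j ∈ Ico p (n - p), 1 / Real.sin ((2 * j + 1) * π / (2 * n)) ^ 2) * (π / n) :=
        mul_le_mul_of_nonneg_left hsinle hS0
    _ = π / n * ∑ j ∈ Ico p (n - p), 1 / Real.sin ((2 * j + 1) * π / (2 * n)) ^ 2 :=
        mul_comm _ _
    _ < _ := hA

/-- **(★′)** (shell `m = 2p+1` odd, `2p + 2 ≤ n`): the `n − 2p − 1` NON-cap half-angles `iπ/n`,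
`p+1 ≤ i ≤ n−p−1`, are the midpoints of the cells `[(2i−1)π/(2n), (2i+1)π/(2n)]` tiling
`[(2p+1)π/(2n), π − (2p+1)π/(2n)]`, so
`Σ_{i=p+1}^{n−p−1} csc²(iπ/n) < (2n/π)·cot((2p+1)π/(2n)) ≤ 2cot((2p+1)π/(2n))/sin(π/n)`. -/
theorem nonCap_sum_lt_odd (n p : ℕ) (hpn : 2 * p + 2 ≤ n) :
    ∑ i ∈ Ico (p + 1) (n - p), 1 / Real.sin (i * π / n) ^ 2
      < 2 * (Real.cos ((2 * p + 1) * π / (2 * n)) / Real.sin ((2 * p + 1) * π / (2 * n)))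
          / Real.sin (π / n) := by
  have hn : 0 < n := by omega
  have hnR : (0 : ℝ) < n := by exact_mod_cast hn
  have hnR0 : (n : ℝ) ≠ 0 := hnR.ne'
  have hpnR : 2 * (p : ℝ) + 2 ≤ n := by exact_mod_cast hpn
  have tel : ∀ (g : ℕ → ℝ) (a b : ℕ), a ≤ b →
      ∑ j ∈ Ico a b, (g j - g (j + 1)) = g a - g b := by
    intro g a b hab
    induction b, hab using Nat.le_induction with
    | base => simp
    | succ b hab ih => rw [Finset.sum_Ico_succ_top hab, ih]; ring
  -- `g i = cot((2i−1)π/(2n))`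
  set g : ℕ → ℝ := fun i => Real.cos ((2 * i - 1) * π / (2 * n)) / Real.sin ((2 * i - 1) * π / (2 * n))
    with hg
  have hcell : ∀ i ∈ Ico (p + 1) (n - p),
      2 * (π / (2 * n)) / Real.sin (i * π / n) ^ 2 < g i - g (i + 1) := by
    intro i hi
    rw [mem_Ico] at hi
    have hi1 : (1 : ℝ) ≤ i := by exact_mod_cast (by omega : 1 ≤ i)
    have hi2 : (i : ℝ) + 1 ≤ n := by exact_mod_cast (by omega : i + 1 ≤ n)
    have hlt1 : π / (2 * n) < i * π / n := by
      rw [show (i : ℝ) * π / n = (2 * i) * π / (2 * n) by field_simp]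
      apply div_lt_div_of_pos_right _ (by positivity)
      nlinarith [Real.pi_pos]
    have hlt2 : i * π / n + π / (2 * n) < π := by
      rw [show (i : ℝ) * π / n + π / (2 * n) = (2 * i + 1) * π / (2 * n) by field_simp,
        div_lt_iff₀ (by positivity)]
      nlinarith [Real.pi_pos]
    have h := midpoint_cell_lt (π / (2 * n)) (i * π / n) (by positivity) hlt1 hlt2
    have ey1 : (i : ℝ) * π / n - π / (2 * n) = (2 * (i : ℝ) - 1) * π / (2 * n) := by
      field_simp
    have ey2 : (i : ℝ) * π / n + π / (2 * n) = (2 * ((i + 1 : ℕ) : ℝ) - 1) * π / (2 * n) := by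
      push_cast; field_simp; ring
    rw [ey1, ey2] at h
    exact h
  have hne : (Ico (p + 1) (n - p)).Nonempty := by rw [Finset.nonempty_Ico]; omega
  have hA : π / n * ∑ i ∈ Ico (p + 1) (n - p), 1 / Real.sin (i * π / n) ^ 2
      < 2 * (Real.cos ((2 * p + 1) * π / (2 * n)) / Real.sin ((2 * p + 1) * π / (2 * n))) := by
    have hlt := Finset.sum_lt_sum_of_nonempty hne hcell
    have eL : ∑ i ∈ Ico (p + 1) (n - p), 2 * (π / (2 * n)) / Real.sin (i * π / n) ^ 2
        = π / n * ∑ i ∈ Ico (p + 1) (n - p), 1 / Real.sin (i * π / n) ^ 2 := by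
      rw [Finset.mul_sum]
      refine sum_congr rfl fun i _ => ?_
      ring
    have eR : ∑ i ∈ Ico (p + 1) (n - p), (g i - g (i + 1))
        = 2 * (Real.cos ((2 * p + 1) * π / (2 * n)) / Real.sin ((2 * p + 1) * π / (2 * n))) := by
      rw [tel g (p + 1) (n - p) (by omega)]
      have ep : (2 * ((p + 1 : ℕ) : ℝ) - 1) * π / (2 * n) = (2 * p + 1) * π / (2 * n) := by
        push_cast; ring
      have ec : (2 * ((n - p : ℕ) : ℝ) - 1) * π / (2 * n) = π - (2 * p + 1) * π / (2 * n) := by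
        rw [Nat.cast_sub (by omega)]; field_simp; ring
      simp only [hg]
      rw [ep, ec, Real.cos_pi_sub, Real.sin_pi_sub]
      ring
    rw [eL, eR] at hlt
    exact hlt
  have hπn : 0 < π / n := by positivity
  have hsinpos : 0 < Real.sin (π / n) := by
    apply Real.sin_pos_of_pos_of_lt_pi hπn
    rw [div_lt_iff₀ hnR]
    nlinarith [Real.pi_pos]
  have hsinle : Real.sin (π / n) ≤ π / n := Real.sin_le hπn.le
  have hS0 : 0 ≤ ∑ i ∈ Ico (p + 1) (n - p), 1 / Real.sin (i * π / n) ^ 2 :=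
    Finset.sum_nonneg fun i _ => by positivity
  rw [lt_div_iff₀ hsinpos]
  calc (∑ i ∈ Ico (p + 1) (n - p), 1 / Real.sin (i * π / n) ^ 2) * Real.sin (π / n)
      ≤ (∑ i ∈ Ico (p + 1) (n - p), 1 / Real.sin (i * π / n) ^ 2) * (π / n) :=
        mul_le_mul_of_nonneg_left hsinle hS0
    _ = π / n * ∑ i ∈ Ico (p + 1) (n - p), 1 / Real.sin (i * π / n) ^ 2 := mul_comm _ _
    _ < _ := hA

/-! ## §3 The assembled `+1 conditions` (Step 3 / 3′) -/

/-- **The `+1 condition`, even shell `m = 2p`** (`θ_F = 2pπ/n`; T-M1D.48 Step 3): with the kernel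
values of Step 1, `n²·T(0) = (1 − cos θ_F)(n² − S_out) + 2 sin θ_F / sin(π/n)`, and the condition
`T(0) > h(0) = 1 − cos θ_F` holds strictly: it is `(★)` times `1 − cos θ_F = 2 sin²(θ_F/2) > 0`. -/
theorem plus_one_condition_even (n p : ℕ) (hp : 1 ≤ p) (hpn : 2 * p + 1 ≤ n) :
    (n : ℝ) ^ 2 * (1 - Real.cos (2 * p * π / n))
      < (1 - Real.cos (2 * p * π / n))
          * ((n : ℝ) ^ 2 - ∑ j ∈ Ico p (n - p), 1 / Real.sin ((2 * j + 1) * π / (2 * n)) ^ 2)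
        + 2 * Real.sin (2 * p * π / n) / Real.sin (π / n) := by
  have hstar := nonCap_sum_lt_even n p hp hpn
  have hnR : (0 : ℝ) < n := by exact_mod_cast (by omega : 0 < n)
  have hpR : (1 : ℝ) ≤ p := by exact_mod_cast hp
  have hpnR : 2 * (p : ℝ) + 1 ≤ n := by exact_mod_cast hpn
  have ha0 : 0 < (p : ℝ) * π / n := div_pos (mul_pos (by linarith) Real.pi_pos) hnR
  have haπ : (p : ℝ) * π / n < π := by
    rw [div_lt_iff₀ hnR]; nlinarith [Real.pi_pos]
  have hsa : 0 < Real.sin (p * π / n) := Real.sin_pos_of_pos_of_lt_pi ha0 haπ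
  have hsa0 : Real.sin (p * π / n) ≠ 0 := hsa.ne'
  have hsn : 0 < Real.sin (π / n) := by
    apply Real.sin_pos_of_pos_of_lt_pi (by positivity)
    rw [div_lt_iff₀ hnR]; nlinarith [Real.pi_pos]
  have hsn0 : Real.sin (π / n) ≠ 0 := hsn.ne'
  have hcos : 1 - Real.cos (2 * p * π / n) = 2 * Real.sin (p * π / n) ^ 2 := by
    rw [Real.sin_sq_eq_half_sub, show 2 * ((p : ℝ) * π / n) = 2 * p * π / n by ring]; ring
  have hsin : Real.sin (2 * p * π / n) = 2 * Real.sin (p * π / n) * Real.cos (p * π / n) := by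
    rw [show (2 * p * π / n : ℝ) = 2 * ((p : ℝ) * π / n) by ring, Real.sin_two_mul]
  have hpos : 0 < 1 - Real.cos (2 * p * π / n) := by rw [hcos]; positivity
  have key : (1 - Real.cos (2 * p * π / n))
        * ∑ j ∈ Ico p (n - p), 1 / Real.sin ((2 * j + 1) * π / (2 * n)) ^ 2
      < 2 * Real.sin (2 * p * π / n) / Real.sin (π / n) := by
    calc (1 - Real.cos (2 * p * π / n))
          * ∑ j ∈ Ico p (n - p), 1 / Real.sin ((2 * j + 1) * π / (2 * n)) ^ 2
        < (1 - Real.cos (2 * p * π / n))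
          * (2 * (Real.cos (p * π / n) / Real.sin (p * π / n)) / Real.sin (π / n)) :=
          mul_lt_mul_of_pos_left hstar hpos
      _ = 2 * Real.sin (2 * p * π / n) / Real.sin (π / n) := by
          rw [hcos, hsin]
          field_simp
  linarith [key]

/-- **The `+1 condition`, odd shell `m = 2p+1`** (`θ_F = (2p+1)π/n`; T-M1D.48 Step 3′): with the
kernel second derivatives of Step 1, `T″(0) = −½(1 − cos θ_F)·S_out′ + sin θ_F/sin(π/n) − 1`, and the
condition `T″(0) > h″(0) = −1` holds strictly: it is `(★′)` times `½(1 − cos θ_F) = sin²(θ_F/2) > 0`. -/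
theorem plus_one_condition_odd (n p : ℕ) (hpn : 2 * p + 2 ≤ n) :
    (-1 : ℝ) < -(1 / 2) * (1 - Real.cos ((2 * p + 1) * π / n))
          * (∑ i ∈ Ico (p + 1) (n - p), 1 / Real.sin (i * π / n) ^ 2)
        + Real.sin ((2 * p + 1) * π / n) / Real.sin (π / n) - 1 := by
  have hstar := nonCap_sum_lt_odd n p hpn
  have hnR : (0 : ℝ) < n := by exact_mod_cast (by omega : 0 < n)
  have hpnR : 2 * (p : ℝ) + 2 ≤ n := by exact_mod_cast hpn
  have ha0 : 0 < (2 * (p : ℝ) + 1) * π / (2 * n) := by positivity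
  have haπ : (2 * (p : ℝ) + 1) * π / (2 * n) < π := by
    rw [div_lt_iff₀ (by positivity)]; nlinarith [Real.pi_pos]
  have hsa : 0 < Real.sin ((2 * p + 1) * π / (2 * n)) := Real.sin_pos_of_pos_of_lt_pi ha0 haπ
  have hsa0 : Real.sin ((2 * p + 1) * π / (2 * n)) ≠ 0 := hsa.ne'
  have hsn : 0 < Real.sin (π / n) := by
    apply Real.sin_pos_of_pos_of_lt_pi (by positivity)
    rw [div_lt_iff₀ hnR]; nlinarith [Real.pi_pos]
  have hsn0 : Real.sin (π / n) ≠ 0 := hsn.ne'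
  have hcos : 1 - Real.cos ((2 * p + 1) * π / n) = 2 * Real.sin ((2 * p + 1) * π / (2 * n)) ^ 2 := by
    rw [Real.sin_sq_eq_half_sub,
      show 2 * ((2 * (p : ℝ) + 1) * π / (2 * n)) = (2 * p + 1) * π / n by field_simp]
    ring
  have hsin : Real.sin ((2 * p + 1) * π / n)
      = 2 * Real.sin ((2 * p + 1) * π / (2 * n)) * Real.cos ((2 * p + 1) * π / (2 * n)) := by
    rw [show ((2 * p + 1) * π / n : ℝ) = 2 * ((2 * (p : ℝ) + 1) * π / (2 * n)) by field_simp,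
      Real.sin_two_mul]
  have hpos : 0 < 1 - Real.cos ((2 * p + 1) * π / n) := by rw [hcos]; positivity
  have key : (1 - Real.cos ((2 * p + 1) * π / n))
        * ∑ i ∈ Ico (p + 1) (n - p), 1 / Real.sin (i * π / n) ^ 2
      < 2 * (Real.sin ((2 * p + 1) * π / n) / Real.sin (π / n)) := by
    calc (1 - Real.cos ((2 * p + 1) * π / n))
          * ∑ i ∈ Ico (p + 1) (n - p), 1 / Real.sin (i * π / n) ^ 2
        < (1 - Real.cos ((2 * p + 1) * π / n))
          * (2 * (Real.cos ((2 * p + 1) * π / (2 * n)) / Real.sin ((2 * p + 1) * π / (2 * n)))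
              / Real.sin (π / n)) :=
          mul_lt_mul_of_pos_left hstar hpos
      _ = 2 * (Real.sin ((2 * p + 1) * π / n) / Real.sin (π / n)) := by
          rw [hcos, hsin]
          field_simp
  linarith [key]

end Summit.Ventures.CertifiedManyBodySolver.Conjectures.CosecantMidpointCells
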